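import Mathlib
import Summits.CriticalPhenomena.CardyFormulaZ2.Theorems.CardyMagicRigidityNestingRigidityGapCrossing
import Summits.CriticalPhenomena.CardyFormulaZ2.Theorems.CardyMagicRigidityNestingRigidityBigLoopsTightZ2
import Summits.CriticalPhenomena.CardyFormulaZ2.Theorems.CardyMagicRigidityNestingRigidityBondDuality
import HarnessLib

/-!
# Crux `NestingRigidity`, line `ring-cloud-tomography` (r5): distinct crossing loops of bond-`ℤ²`
# carry disjoint open crossings — the deterministic core of keystone K2 on `ℤ²`

Crux `Summit.CriticalPhenomena.CardyFormulaZ2.Theses.CardyMagicRigidity.NestingRigidity`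
(stmt-CriticalPhenomena-4835), line `ring-cloud-tomography`, keystone helper K2 (expected NUMBER of
loops meeting a small ball and leaving a big one; site-`𝕋` half landed in `…LoopCrossCountT`).  On
`δ𝕋` the tree has the several-loops Aizenman–Burchard lemma `mem_disjointOccurrencePow_of_loops`; on
bond-`ℤ²` (DKKMO's medial interface loops) it has the single-loop dictionary only
(`GapCrossing.mem_annulusOpenCrossing_of_isInterfaceLoop`).  This file supplies the many-loops
version on `ℤ²` through the loops ↔ clusters dictionary instead of planar topology, with no cited
fact and no definition:

* §1 **a cluster has one exterior boundary** (Nolin 2008, §5.2 "a cluster has one top", as in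
  `…BigLoopsTightZ2Part1`): for a counter-clockwise (type-`1`) interface loop of a lattice
  configuration, the dart of the corner `(x, 0)` at a HIGHEST vertex `x` of the open cluster of its
  rim lies on the loop (`LoopCrossCount.mem_zip_top_of_loopType_eq_one`: the rim cluster is inside,
  `W = 1`, the face above-right of `x` is outside, jump relation); the rim cluster is finite; hence two
  type-`1` loops whose rim clusters meet draw the same unbased loop
  (`LoopCrossCount.unbasedLoop_eq_of_reachable`, via `IsInterfaceLoop.rotate_eq_of_corner`);
* §2 **witnesses**: the open edges of `ω` at the rim cluster form by themselves a configuration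
  crossing the annulus (`LoopCrossCount.sep_mem_annulusOpenCrossing`), and witnesses at different
  clusters are disjoint (`LoopCrossCount.disjoint_sep_of_not_reachable`);
* §3 `k` distinct type-`1` loops meeting `B̄(x, a)` and `ℂ ∖ B(x, b)` (`a + 2δ ≤ b`) put `ω` in
  `(annulusOpenCrossing x δ (a + δ) (b - δ))^{□ k}`
  (`LoopCrossCount.mem_disjointOccurrencePow_of_le_ncard_typeOne`,
  `mem_disjointOccurrencePow_of_pairwise_disjoint`);
* §4 **type `0` by duality**: clockwise crossing loops of `ω` are, translated by `-δ(1+i)/2` and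
  reversed, counter-clockwise crossing loops of `dualConfig ω` (`mem_bondLoopConfig_dualConfig_iff`,
  `…BondDuality`), an injection (`LoopCrossCount.ncard_typeZero_le_ncard_typeOne_dualConfig`);
* §5 the anchor `mem_disjointOccurrencePow_or_dualConfig_of_le_ncard_cross_zEns`: `2k` crossing
  loops of `zEns.X δ ω` give `k` disjoint open annulus crossings of `ω`, or of `dualConfig ω` about
  the centre shifted by `-δ(1+i)/2`.

The probabilistic half (BK–Reimer, RSW, self-duality, summation) is in `…LoopCrossCount`.
-/

noncomputable section

open MeasureTheory Set Filter Metric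
open scoped Real Topology BigOperators ENNReal

namespace Summit.CriticalPhenomena.CardyFormulaZ2.Cruxes.NestingRigidity.RingCloudTomography

open Literature.Probability.RandomPlanarGeometry Literature.Probability.Percolation
  Literature.Probability.LatticeModels
open Summit.CriticalPhenomena.CardyFormulaZ2.Cruxes.NestingRigidity.MarkovCascadeOneGeneration
  (exists_left_dist_le_mesh wind_eq_zero_of_forall_im_le mem_bondLoopConfig_dualConfig_iff
    map_translate_map_translate_neg continuous_translate isometry_translate)

namespace LoopCrossCount

variable {ω : BondConfig (Site 2)} {γ γ' : List MedialVertex}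

/-! ## §1 Type-`1` loops: the top corner of the rim cluster, injectivity of loop ↦ cluster -/

/-- **The top dart.**  Let `γ` be a counter-clockwise (type `1`) interface loop of a lattice
configuration `ω`, `p` one of its darts and `x` a highest vertex (maximal second coordinate) of the
open cluster of the left vertex `p.1` (the rim cluster, which lies inside the loop).  Then the dart of
the corner `(x, 0)` lies on `γ`: the trace stays below height `x₁ + ½`
(`IsInterfaceLoop.exists_reachable_dist_le`), so the centre of the face above-right of `x` is outside
(`wind_eq_zero_of_forall_im_le`), while `W(x) = 1` (`IsInterfaceLoop.wind_eq_of_mem_openCluster`,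
`wind_left_eq_one`); the jump relation `wind_sub_wind_cFace` across the corner forces the dart onto
the loop (Nolin 2008, §5.2, "a cluster has one top"). -/
theorem mem_zip_top_of_loopType_eq_one (h : IsInterfaceLoop ω γ) (hω : ω ⊆ (zdGraph 2).edgeSet)
    (ht : loopType γ = 1) {p : Site 2 × Fin 4} (hp : (cSrc p, cTgt p) ∈ γ.zip (γ.rotate 1))
    {x : Site 2} (hx : (openGraph ω).Reachable p.1 x)
    (hmax : ∀ y, (openGraph ω).Reachable p.1 y → y 1 ≤ x 1) :
    (cSrc (x, 0), cTgt (x, 0)) ∈ γ.zip (γ.rotate 1) := by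
  set c := loopCurve 1 0 γ with hc
  have hW : ∀ y, (openGraph ω).Reachable p.1 y → c.wind (meshPoint 1 y) = 1 := fun y hy ↦ by
    rw [← h.wind_eq_of_mem_openCluster hω hy]
    exact h.wind_left_eq_one ht hp
  -- the trace stays below height `x 1 + 1/2`
  have htr : ∀ z ∈ c.range, z.im ≤ (x 1 : ℝ) + 1 / 2 := by
    intro z hz
    obtain ⟨y, hy, hdz⟩ := h.exists_reachable_dist_le hp hz
    have h1 : (y 1 : ℝ) ≤ x 1 := by exact_mod_cast hmax y (hy.mono inf_le_left)
    have h2 : |z.im - (meshPoint 1 y).im| ≤ dist z (meshPoint 1 y) := by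
      rw [Complex.dist_eq, ← Complex.sub_im]
      exact Complex.abs_im_le_norm _
    rw [meshPoint_im, one_mul] at h2
    have := (abs_le.1 (h2.trans hdz)).2
    linarith
  -- the face above-right of `x` is outside
  have hface : c.wind (faceCenter (cFace (x, 0))) = 0 := by
    refine wind_eq_zero_of_forall_im_le h htr ?_ fun hmem ↦ ?_
    · have : (faceCenter (cFace (x, (0 : Fin 4)))).im = (x 1 : ℝ) + 1 / 2 := by
        rw [faceCenter_im]
        simp [cFace, faceAt, cornerOff]
      rw [this]
    · have h1 := h.le_infDist_faceCenter (cFace (x, 0))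
      rw [Metric.infDist_zero_of_mem hmem] at h1
      have h2 : (0 : ℝ) < Real.sqrt 2 / 4 := by positivity
      linarith
  have hj := h.wind_sub_wind_cFace (x, 0)
  by_contra hnot
  rw [if_neg hnot] at hj
  change c.wind (meshPoint 1 x) - c.wind (faceCenter (cFace (x, 0))) = 0 at hj
  rw [hface, hW x hx] at hj
  norm_num at hj

/-- **The rim cluster of a counter-clockwise interface loop is finite**: it lies inside the loop
(`W = 1`), hence in a ball containing the trace. -/
theorem finite_setOf_reachable_of_loopType_eq_one (h : IsInterfaceLoop ω γ)
    (hω : ω ⊆ (zdGraph 2).edgeSet) (ht : loopType γ = 1) {p : Site 2 × Fin 4}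
    (hp : (cSrc p, cTgt p) ∈ γ.zip (γ.rotate 1)) :
    {y | (openGraph ω).Reachable p.1 y}.Finite := by
  set c := loopCurve 1 0 γ with hc
  obtain ⟨B, hB⟩ := c.isCompact_range.isBounded.subset_ball (0 : ℂ)
  have hin : ∀ y, (openGraph ω).Reachable p.1 y → ‖meshPoint 1 y‖ < B := fun y hy ↦ by
    by_contra hle
    push Not at hle
    have h0 := c.wind_eq_zero_of_subset_ball hB (by rwa [dist_zero_right])
    have h1 : c.wind (meshPoint 1 y) = 1 := by
      rw [← h.wind_eq_of_mem_openCluster hω hy]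
      exact h.wind_left_eq_one ht hp
    omega
  exact (box 2 ⌈B⌉₊).finite_toSet.subset fun y hy ↦ mem_box_ceil_of_norm_lt (hin y hy)

/-- **Two counter-clockwise interface loops of one lattice configuration whose rim clusters meet
draw the same unbased loop** (at every mesh): a highest vertex `x` of the common rim cluster puts the
dart of the corner `(x, 0)` on both loops (`mem_zip_top_of_loopType_eq_one`), so the two dart lists
are rotations of one another (`IsInterfaceLoop.rotate_eq_of_corner`) and draw the same unbased loop
(`unbasedLoop_loopCurve_rotate`).  This is the injectivity of "type-`1` loop ↦ open cluster of its
rim" (DKKMO: `F₁` = exterior boundaries of primal clusters). -/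
theorem unbasedLoop_eq_of_reachable (h : IsInterfaceLoop ω γ) (h' : IsInterfaceLoop ω γ')
    (hω : ω ⊆ (zdGraph 2).edgeSet) (ht : loopType γ = 1) (ht' : loopType γ' = 1)
    {p p' : Site 2 × Fin 4} (hp : (cSrc p, cTgt p) ∈ γ.zip (γ.rotate 1))
    (hp' : (cSrc p', cTgt p') ∈ γ'.zip (γ'.rotate 1)) (hreach : (openGraph ω).Reachable p.1 p'.1)
    (δ : ℝ) :
    UnbasedLoop.mk (BasedLoop.mk (loopCurve δ 0 γ) (isLoop_loopCurve δ 0 h.ne_nil)) =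
      UnbasedLoop.mk (BasedLoop.mk (loopCurve δ 0 γ') (isLoop_loopCurve δ 0 h'.ne_nil)) := by
  classical
  have hfin := finite_setOf_reachable_of_loopType_eq_one h hω ht hp
  obtain ⟨x, hx, hmax⟩ := hfin.toFinset.exists_max_image (fun y ↦ y 1)
    ⟨p.1, hfin.mem_toFinset.2 (SimpleGraph.Reachable.refl _)⟩
  rw [Set.Finite.mem_toFinset] at hx
  have hmax' : ∀ y, (openGraph ω).Reachable p.1 y → y 1 ≤ x 1 := fun y hy ↦
    hmax y (hfin.mem_toFinset.2 hy)
  have hd : (cSrc (x, 0), cTgt (x, 0)) ∈ γ.zip (γ.rotate 1) :=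
    mem_zip_top_of_loopType_eq_one h hω ht hp hx hmax'
  have hd' : (cSrc (x, 0), cTgt (x, 0)) ∈ γ'.zip (γ'.rotate 1) :=
    mem_zip_top_of_loopType_eq_one h' hω ht' hp' (hreach.symm.trans hx)
      fun y hy ↦ hmax' y (hreach.trans hy)
  obtain ⟨i, hi, hps, hpt⟩ := h.exists_pos_of_mem_zip hd
  obtain ⟨j, hj, hps', hpt'⟩ := h'.exists_pos_of_mem_zip hd'
  have hrot := h.rotate_eq_of_corner h' hi hj hps hpt hps' hpt'
  subst hrot
  exact (unbasedLoop_loopCurve_rotate δ 0 h.ne_nil _).symm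

/-! ## §2 Witnesses: the open edges at the rim cluster -/

/-- **Open lattice walks from the cluster of `v₀` use only open edges at that cluster**: a walk of
open lattice edges of `ω` starting at a vertex of the open cluster of `v₀` is a walk of open lattice
edges of the sub-configuration `{e ∈ ω | e has an endpoint in the cluster of v₀}`. -/
theorem reachable_sep_of_walk {v₀ a b : Site 2} (ha : (openGraph ω).Reachable v₀ a)
    (W : (openGraph ω ⊓ zdGraph 2).Walk a b) :
    (openGraph {e ∈ ω | ∃ y, (openGraph ω).Reachable v₀ y ∧ y ∈ e} ⊓ zdGraph 2).Reachable a b := by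
  induction W with
  | nil => exact SimpleGraph.Reachable.refl _
  | @cons a a' b hadj W ih =>
    have hadj' := (SimpleGraph.inf_adj _ _ _ _).1 hadj
    have hω' : s(a, a') ∈ ω := ((openGraph_adj _ _ _).1 hadj'.1).1
    have ha' : (openGraph ω).Reachable v₀ a' := ha.trans hadj'.1.reachable
    have hstep : (openGraph {e ∈ ω | ∃ y, (openGraph ω).Reachable v₀ y ∧ y ∈ e} ⊓ zdGraph 2).Adj
        a a' := by
      rw [SimpleGraph.inf_adj, openGraph_adj]
      exact ⟨⟨⟨hω', a, ha, Sym2.mem_mk_left _ _⟩, hadj'.2.ne⟩, hadj'.2⟩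
    exact hstep.reachable.trans (ih ha')

/-- **The witness crosses the annulus.**  If an interface loop of `ω` drawn at mesh `δ > 0` has a
trace point within `a` of `x` and one at distance `≥ b` from `x` (`a + 2δ ≤ b`), then the open edges
of `ω` at the rim cluster of any of its darts form, by themselves, a configuration in
`annulusOpenCrossing x δ (a + δ) (b - δ)` (as in
`GapCrossing.mem_annulusOpenCrossing_of_isInterfaceLoop`: the rim walk between the left vertices
near the two points, `IsInterfaceLoop.reachable_left`, read in the sub-configuration by
`reachable_sep_of_walk` and stopped at its first exit, `GapCrossing.exists_exit_openConnIn`). -/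
theorem sep_mem_annulusOpenCrossing (h : IsInterfaceLoop ω γ) {δ : ℝ} (hδ : 0 < δ) (x : ℂ)
    {a b : ℝ} (hab : a + 2 * δ ≤ b) {p : Site 2 × Fin 4} (hp : (cSrc p, cTgt p) ∈ γ.zip (γ.rotate 1))
    {z z' : ℂ} (hz : z ∈ (loopCurve δ 0 γ).range) (hz' : z' ∈ (loopCurve δ 0 γ).range)
    (hza : dist z x ≤ a) (hz'b : b ≤ dist z' x) :
    {e ∈ ω | ∃ y, (openGraph ω).Reachable p.1 y ∧ y ∈ e} ∈
      annulusOpenCrossing x δ (a + δ) (b - δ) := by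
  obtain ⟨q, hq, hqz⟩ := exists_left_dist_le_mesh h δ hz
  obtain ⟨q', hq', hq'z⟩ := exists_left_dist_le_mesh h δ hz'
  rw [abs_of_pos hδ] at hqz hq'z
  have hqa : dist (meshPoint δ q.1) x ≤ a + δ / 2 := by
    linarith [dist_triangle (meshPoint δ q.1) z x, dist_comm z (meshPoint δ q.1)]
  have hq'b : b - δ / 2 ≤ dist (meshPoint δ q'.1) x := by
    linarith [dist_triangle z' (meshPoint δ q'.1) x]
  obtain ⟨W⟩ := h.reachable_left hq hq'
  have hpq : (openGraph ω).Reachable p.1 q.1 := (h.reachable_left hp hq).mono inf_le_left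
  obtain ⟨W'⟩ := reachable_sep_of_walk hpq W
  obtain ⟨w, hw, hconn⟩ :=
    GapCrossing.exists_exit_openConnIn hδ.le x (b - δ) W' (by linarith) (by linarith)
  exact mem_annulusOpenCrossing_iff.2 ⟨q.1, by linarith, w, hw, hconn⟩

/-- **Witnesses at different clusters are disjoint**: an open edge of a lattice configuration with an
endpoint in the cluster of `v` and an endpoint in the cluster of `v'` joins the two clusters. -/
theorem disjoint_sep_of_not_reachable (hω : ω ⊆ (zdGraph 2).edgeSet) {v v' : Site 2}
    (hnr : ¬ (openGraph ω).Reachable v v') :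
    Disjoint {e ∈ ω | ∃ y, (openGraph ω).Reachable v y ∧ y ∈ e}
      {e ∈ ω | ∃ y, (openGraph ω).Reachable v' y ∧ y ∈ e} := by
  rw [Set.disjoint_left]
  rintro e ⟨he, y, hy, hye⟩ ⟨-, y', hy', hy'e⟩
  revert he hye hy'e
  refine Sym2.ind (fun a b ↦ ?_) e
  intro he hye hy'e
  have hadj : (openGraph ω).Adj a b :=
    (openGraph_adj _ _ _).2 ⟨he, ((SimpleGraph.mem_edgeSet _).1 (hω he)).ne⟩
  have hab : (openGraph ω).Reachable a b := hadj.reachable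
  rcases Sym2.mem_iff.1 hye with rfl | rfl <;> rcases Sym2.mem_iff.1 hy'e with rfl | rfl
  · exact hnr (hy.trans hy'.symm)
  · exact hnr (hy.trans (hab.trans hy'.symm))
  · exact hnr (hy.trans (hab.symm.trans hy'.symm))
  · exact hnr (hy.trans hy'.symm)

/-! ## §3 Many type-`1` crossing loops force many disjoint open crossings -/

/-- **Distinct counter-clockwise crossing loops give disjoint open crossings.**  For a lattice
configuration `ω` at mesh `δ > 0`: if at least `k` loops of type `1` of `bondLoopConfig δ 0 ω` meet
`B̄(x, a)` and `ℂ ∖ B(x, b)` (`a + 2δ ≤ b`), then `ω ∈ (annulusOpenCrossing x δ (a + δ) (b - δ))^{□ k}`: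
the rim clusters of `k` distinct type-`1` loops are pairwise distinct (`unbasedLoop_eq_of_reachable`),
so the open edges at them are pairwise disjoint witnesses (`disjoint_sep_of_not_reachable`), each
crossing the annulus (`sep_mem_annulusOpenCrossing`); `mem_disjointOccurrencePow_of_pairwise_disjoint`. -/
theorem mem_disjointOccurrencePow_of_le_ncard_typeOne (hω : ω ⊆ (zdGraph 2).edgeSet) {δ : ℝ}
    (hδ : 0 < δ) (x : ℂ) {a b : ℝ} (hab : a + 2 * δ ≤ b) {k : ℕ}
    (hk : k ≤ {u ∈ (bondLoopConfig δ 0 ω).F 1 | (u.range ∩ Metric.closedBall x a).Nonempty ∧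
        (u.range ∩ (Metric.ball x b)ᶜ).Nonempty}.ncard) :
    ω ∈ disjointOccurrencePow (annulusOpenCrossing x δ (a + δ) (b - δ)) k := by
  classical
  rcases Nat.eq_zero_or_pos k with rfl | hkpos
  · rw [disjointOccurrencePow_zero]; exact Set.mem_univ _
  set S := {u ∈ (bondLoopConfig δ 0 ω).F 1 | (u.range ∩ Metric.closedBall x a).Nonempty ∧
        (u.range ∩ (Metric.ball x b)ᶜ).Nonempty} with hSdef
  have hSfin : S.Finite := Set.finite_of_ncard_pos (by omega)
  obtain ⟨t, htS, htcard⟩ := Set.exists_subset_encard_eq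
    (show ((k : ℕ) : ℕ∞) ≤ S.encard by rw [← hSfin.cast_ncard_eq]; exact_mod_cast hk)
  have htfin : t.Finite := hSfin.subset htS
  have hcardT : htfin.toFinset.card = k := by
    have h := htfin.encard_eq_coe_toFinset_card
    rw [htcard] at h
    exact_mod_cast h.symm
  set e := (htfin.toFinset.equivFinOfCardEq hcardT).symm with he
  set u : Fin k → UnbasedLoop ℂ := fun i ↦ (e i : UnbasedLoop ℂ) with hudef
  have huS : ∀ i, u i ∈ S := fun i ↦ htS (htfin.mem_toFinset.1 (e i).2)
  have huinj : Function.Injective u := fun i i' h ↦ e.injective (Subtype.ext h)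
  -- type-`1` representatives and a dart of each
  have hrep : ∀ i, ∃ (γ : List MedialVertex) (h : IsInterfaceLoop ω γ), loopType γ = 1 ∧
      u i = UnbasedLoop.mk (BasedLoop.mk (loopCurve δ 0 γ) (isLoop_loopCurve δ 0 h.ne_nil)) :=
    fun i ↦ mem_bondLoopConfig_iff.1 (huS i).1
  choose γ hγ htγ hγu using hrep
  have hdart : ∀ i, ∃ p : Site 2 × Fin 4, (cSrc p, cTgt p) ∈ (γ i).zip ((γ i).rotate 1) := fun i ↦ by
    obtain ⟨p, hps, hpt⟩ := (hγ i).exists_corner 0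
    exact ⟨p, by rw [hps, hpt]; exact (hγ i).getElem_mod_mem_zip 0⟩
  choose p hp using hdart
  refine mem_disjointOccurrencePow_of_pairwise_disjoint (isUpperSet_annulusOpenCrossing x δ _ _)
    (fun i ↦ {e ∈ ω | ∃ y, (openGraph ω).Reachable (p i).1 y ∧ y ∈ e}) (fun i ↦ Set.sep_subset _ _)
    (fun i ↦ ?_) (fun i j hij ↦ ?_)
  · obtain ⟨-, ⟨z, hzu, hza⟩, ⟨z', hz'u, hz'b⟩⟩ := huS i
    rw [hγu i] at hzu hz'u
    exact sep_mem_annulusOpenCrossing (hγ i) hδ x hab (hp i) hzu hz'u (mem_closedBall.1 hza)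
      (not_lt.1 fun hlt ↦ hz'b (mem_ball.2 hlt))
  · refine disjoint_sep_of_not_reachable hω fun hreach ↦ hij (huinj ?_)
    rw [hγu i, hγu j]
    exact unbasedLoop_eq_of_reachable (hγ i) (hγ j) hω (htγ i) (htγ j) (hp i) (hp j) hreach δ

/-! ## §4 Type-`0` loops are type-`1` loops of the dual configuration -/

/-- **Clockwise crossing loops of `ω` are counter-clockwise crossing loops of `dualConfig ω`**, half
a mesh below-left (`mem_bondLoopConfig_dualConfig_iff`, `…BondDuality`): the number of type-`0` loops
of `bondLoopConfig δ 0 ω` meeting `B̄(x, a)` and `ℂ ∖ B(x, b)` is at most the number of type-`1`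
loops of `bondLoopConfig δ 0 (dualConfig ω)` meeting `B̄(x - δ(1+i)/2, a)` and
`ℂ ∖ B(x - δ(1+i)/2, b)` (translate by `-δ(1+i)/2` and reverse: an injection). -/
theorem ncard_typeZero_le_ncard_typeOne_dualConfig (hω : ω ⊆ (zdGraph 2).edgeSet) {δ : ℝ}
    (hδ : 0 < δ) (x : ℂ) (a b : ℝ) :
    {u ∈ (bondLoopConfig δ 0 ω).F 0 | (u.range ∩ Metric.closedBall x a).Nonempty ∧
        (u.range ∩ (Metric.ball x b)ᶜ).Nonempty}.ncard ≤
      {v ∈ (bondLoopConfig δ 0 (dualConfig ω)).F 1 |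
        (v.range ∩ Metric.closedBall (x - δ * (1 + Complex.I) / 2) a).Nonempty ∧
        (v.range ∩ (Metric.ball (x - δ * (1 + Complex.I) / 2) b)ᶜ).Nonempty}.ncard := by
  set g : UnbasedLoop ℂ → UnbasedLoop ℂ := fun u ↦
    (u.map ⟨fun w ↦ 1 * w + -(δ * (1 + Complex.I) / 2), continuous_translate _⟩
      (isometry_translate _)).reverse with hg
  -- `g` has a left inverse (translate back and reverse)
  have hback : ∀ u : UnbasedLoop ℂ, ((g u).map ⟨fun w ↦ 1 * w + δ * (1 + Complex.I) / 2,
      continuous_translate (δ * (1 + Complex.I) / 2)⟩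
      (isometry_translate (δ * (1 + Complex.I) / 2))).reverse = u := by
    intro u
    have key := map_translate_map_translate_neg u (-(δ * (1 + Complex.I) / 2))
    simp only [neg_neg] at key
    rw [hg]
    dsimp only
    rw [← UnbasedLoop.reverse_map, UnbasedLoop.reverse_reverse, key]
  have hginj : Function.Injective g := fun u₁ u₂ h12 ↦ by
    rw [← hback u₁, ← hback u₂, h12]
  -- the range of `g u` is the translate of the range of `u`
  have hrange : ∀ (u : UnbasedLoop ℂ) (z : ℂ), z ∈ u.range →
      z - δ * (1 + Complex.I) / 2 ∈ (g u).range := by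
    intro u z hz
    rw [hg]
    dsimp only
    rw [UnbasedLoop.range_reverse, UnbasedLoop.range_map]
    exact ⟨z, hz, by simp [sub_eq_add_neg]⟩
  -- finiteness of the target
  have hfin : {v ∈ (bondLoopConfig δ 0 (dualConfig ω)).F 1 |
      (v.range ∩ Metric.closedBall (x - δ * (1 + Complex.I) / 2) a).Nonempty ∧
      (v.range ∩ (Metric.ball (x - δ * (1 + Complex.I) / 2) b)ᶜ).Nonempty}.Finite := by
    refine (ncard_loops_meeting_le hδ (‖x - δ * (1 + Complex.I) / 2‖ + a) (dualConfig ω)).1.subset ?_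
    rintro v ⟨hv, ⟨z, hzv, hza⟩, -⟩
    refine ⟨Or.inr hv, z, hzv, ?_⟩
    rw [mem_closedBall, dist_zero_right]
    rw [mem_closedBall] at hza
    calc ‖z‖ = dist z 0 := (dist_zero_right z).symm
      _ ≤ dist z (x - δ * (1 + Complex.I) / 2) + dist (x - δ * (1 + Complex.I) / 2) 0 :=
          dist_triangle _ _ _
      _ ≤ ‖x - δ * (1 + Complex.I) / 2‖ + a := by rw [dist_zero_right]; linarith
  calc {u ∈ (bondLoopConfig δ 0 ω).F 0 | (u.range ∩ Metric.closedBall x a).Nonempty ∧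
          (u.range ∩ (Metric.ball x b)ᶜ).Nonempty}.ncard
      = (g '' {u ∈ (bondLoopConfig δ 0 ω).F 0 | (u.range ∩ Metric.closedBall x a).Nonempty ∧
          (u.range ∩ (Metric.ball x b)ᶜ).Nonempty}).ncard :=
        (Set.ncard_image_of_injective _ hginj).symm
    _ ≤ _ := by
        refine Set.ncard_le_ncard ?_ hfin
        rintro _ ⟨u, ⟨hu, ⟨z, hzu, hza⟩, ⟨z', hz'u, hz'b⟩⟩, rfl⟩
        refine ⟨?_, ⟨z - δ * (1 + Complex.I) / 2, hrange u z hzu, ?_⟩,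
          ⟨z' - δ * (1 + Complex.I) / 2, hrange u z' hz'u, ?_⟩⟩
        · rw [mem_bondLoopConfig_dualConfig_iff δ ω hω 1 (g u), hback u]
          exact hu
        · rw [mem_closedBall] at hza ⊢
          rwa [dist_sub_right]  -- dist (z - c) (x - c) = dist z x
        · rw [Set.mem_compl_iff, mem_ball] at hz'b ⊢
          rwa [dist_sub_right]

end LoopCrossCount

/-! ## §5 The deterministic core of K2 on bond-`ℤ²` (anchor) -/

/-- **Many crossing loops of bond-`ℤ²` force many disjoint open crossings of the primal or of the
dual configuration** (helper toward keystone K2 `integral_ncard_loops_cross_le`, line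
`ring-cloud-tomography`).  For a lattice configuration `ω ⊆ E(ℤ²)` at mesh `δ > 0` and radii with
`a + 2δ ≤ b`: if at least `2k` loops of `zEns.X δ ω = bondLoopConfig δ 0 ω` meet `B̄(x, a)` and
`ℂ ∖ B(x, b)`, then `k` of them have one type; `k` counter-clockwise ones give
`ω ∈ (annulusOpenCrossing x δ (a + δ) (b - δ))^{□ k}`
(`LoopCrossCount.mem_disjointOccurrencePow_of_le_ncard_typeOne`), and `k` clockwise ones are `k`
counter-clockwise crossing loops of `dualConfig ω` half a mesh below-left
(`LoopCrossCount.ncard_typeZero_le_ncard_typeOne_dualConfig`), whence the same for `dualConfig ω`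
about the shifted centre. -/
theorem mem_disjointOccurrencePow_or_dualConfig_of_le_ncard_cross_zEns :
    ∀ (ω : BondConfig (Site 2)) (δ : ℝ) (x : ℂ) (a b : ℝ) (k : ℕ), ω ⊆ (zdGraph 2).edgeSet →
      0 < δ → a + 2 * δ ≤ b →
      2 * k ≤ {u ∈ (zEns.X δ ω).loops | (u.range ∩ Metric.closedBall x a).Nonempty ∧
        (u.range ∩ (Metric.ball x b)ᶜ).Nonempty}.ncard →
      ω ∈ disjointOccurrencePow (annulusOpenCrossing x δ (a + δ) (b - δ)) k ∨
        dualConfig ω ∈ disjointOccurrencePow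
          (annulusOpenCrossing (x - δ * (1 + Complex.I) / 2) δ (a + δ) (b - δ)) k := by
  intro ω δ x a b k hω hδ hab hk
  -- the crossing loops split by type
  have hsplit : {u ∈ (zEns.X δ ω).loops | (u.range ∩ Metric.closedBall x a).Nonempty ∧
      (u.range ∩ (Metric.ball x b)ᶜ).Nonempty} =
      {u ∈ (bondLoopConfig δ 0 ω).F 0 | (u.range ∩ Metric.closedBall x a).Nonempty ∧
        (u.range ∩ (Metric.ball x b)ᶜ).Nonempty} ∪
      {u ∈ (bondLoopConfig δ 0 ω).F 1 | (u.range ∩ Metric.closedBall x a).Nonempty ∧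
        (u.range ∩ (Metric.ball x b)ᶜ).Nonempty} := by
    ext u
    simp only [Set.mem_setOf_eq, Set.mem_union]
    change (u ∈ (bondLoopConfig δ 0 ω).loops ∧ _) ↔ _
    rw [LoopConfig.mem_loops_iff]
    tauto
  rw [hsplit] at hk
  have hle := Set.ncard_union_le
    {u ∈ (bondLoopConfig δ 0 ω).F 0 | (u.range ∩ Metric.closedBall x a).Nonempty ∧
      (u.range ∩ (Metric.ball x b)ᶜ).Nonempty}
    {u ∈ (bondLoopConfig δ 0 ω).F 1 | (u.range ∩ Metric.closedBall x a).Nonempty ∧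
      (u.range ∩ (Metric.ball x b)ᶜ).Nonempty}
  by_cases h1 : k ≤ {u ∈ (bondLoopConfig δ 0 ω).F 1 | (u.range ∩ Metric.closedBall x a).Nonempty ∧
      (u.range ∩ (Metric.ball x b)ᶜ).Nonempty}.ncard
  · exact Or.inl (LoopCrossCount.mem_disjointOccurrencePow_of_le_ncard_typeOne hω hδ x hab h1)
  · right
    have h0 : k ≤ {u ∈ (bondLoopConfig δ 0 ω).F 0 | (u.range ∩ Metric.closedBall x a).Nonempty ∧
        (u.range ∩ (Metric.ball x b)ᶜ).Nonempty}.ncard := by omega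
    have hωd : dualConfig ω ⊆ (zdGraph 2).edgeSet := Set.sdiff_subset
    exact LoopCrossCount.mem_disjointOccurrencePow_of_le_ncard_typeOne hωd hδ _ hab
      (h0.trans (LoopCrossCount.ncard_typeZero_le_ncard_typeOne_dualConfig hω hδ x a b))

end Summit.CriticalPhenomena.CardyFormulaZ2.Cruxes.NestingRigidity.RingCloudTomography

end
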